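import Mathlib
import HarnessLib
import Summits.RiemannHypothesis.RiemannHypothesis.Theorems.IntegerScrewWalkGenerator

/-!
# Route `IntegerScrew` — the PRIME-PARITY FUNCTIONS are exact eigenfunctions of the truncated walk up to a
# BLOCKED-BIRTH DEFECT on the top bands: `ℒ_M φ_p = −(λ_p/L)·φ_p + (1/L)·r_p`, `0 ≤ r_p ≤ log p/(p−1)`,
# `r_p(k) = log p/(p−1)` exactly when `pk > M` (PIVOT-LAW 13.10 (iv); CONTINUUM-LIMIT 23.18 (f))

For a prime `p` let `φ_p(x) = 1/p` if `p ∤ x` and `−(1 − 1/p)` if `p ∣ x` (the indicator of «`p` absent»,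
centred for the untruncated harmonic measure) and `λ_p = p·log p/(p−1)` (the prime-parity rate of PIVOT-LAW
13.8/13.10 (iv)).  For the τ-time generator `walkGen M` of the truncated multiplicative walk
(`IntegerScrewWalkGenerator`: births `k → kn` at rate `Λ(n)/(nL)` while `kn ≤ M`, deaths `k → k/d` at rate
`Λ(d)/L`) this file proves the exact relation behind CONJECTURE Σ's first-order depth computation
(CONTINUUM-LIMIT 23.18 (f): `Λ_{p} = λ_p − p·log²p/((p−1)²H_M) + O(L⁻²)`):

* `sum_divisors_vonMangoldt_parity` — deaths: `Σ_{d ∣ k} Λ(d)·(φ_p(k/d) − φ_p(k)) = 𝟙[p ∣ k]·log p` (only the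
  death of the full power `p^{v_p(k)}` flips the indicator);
* `sum_Icc_vonMangoldt_parity` — births: `Σ_{n ≤ M/k} (Λ(n)/n)·(φ_p(kn) − φ_p(k)) = −𝟙[p ∤ k]·Σ_{n ≤ M/k, p ∣ n} Λ(n)/n`;
* `walkGen_parity` — **`Σ_j walkGen(k,j)·φ_p(j) = −(λ_p/L)·φ_p(k) + (1/L)·r_p(k)`** with the defect
  `r_p(k) = 𝟙[p ∤ k]·(log p/(p−1) − Σ_{n ≤ M/k, p ∣ n} Λ(n)/n)`;
* `sum_Icc_dvd_vonMangoldt_div_le` — `Σ_{n ≤ y, p ∣ n} Λ(n)/n ≤ log p/(p−1)` (only powers of `p` contribute),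
  hence `parityDefect_nonneg`, `parityDefect_le`; and `parityDefect_eq_of_lt` — `r_p(k) = log p/(p−1)` when
  `M/k < p` (no birth of `p` possible: the top band).

RH-free arithmetic of the walk; nothing here bears on the truth of RH.  References: PIVOT-LAW §13.8, §13.10 (iv),
CONTINUUM-LIMIT §23.18 (rh-explicit A6-PIVOT); M. Suzuki, J. Lond. Math. Soc. (2) 108 (2023) 1448–1487
[Suzuki2023] for the screw matrices whose pivot law this serves.
-/

noncomputable section

-- D-0017: `Summit.<S>.<S>.…` is the designed namespace of a single-problem summit.
set_option linter.dupNamespace false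

namespace Summit.RiemannHypothesis.RiemannHypothesis.Theorems.IntegerScrew

open Finset ArithmeticFunction

/-- The prime-parity function `φ_p`: `1/p` off the multiples of `p`, `−(1 − 1/p)` on them. -/
def parityFun (p : ℕ) (x : ℕ) : ℝ := if p ∣ x then -(1 - (p : ℝ)⁻¹) else (p : ℝ)⁻¹

/-- `φ_p = −(1 − 1/p)` on the multiples of `p`. -/
theorem parityFun_of_dvd {p x : ℕ} (h : p ∣ x) : parityFun p x = -(1 - (p : ℝ)⁻¹) := by
  simp [parityFun, h]

/-- `φ_p = 1/p` off the multiples of `p`. -/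
theorem parityFun_of_not_dvd {p x : ℕ} (h : ¬ p ∣ x) : parityFun p x = (p : ℝ)⁻¹ := by
  simp [parityFun, h]

/-- The flip: `φ_p(x) − φ_p(y) = 1` when `p ∤ x`, `p ∣ y`. -/
theorem parityFun_sub_of_not_dvd_of_dvd {p x y : ℕ} (hx : ¬ p ∣ x) (hy : p ∣ y) :
    parityFun p x - parityFun p y = 1 := by
  rw [parityFun_of_not_dvd hx, parityFun_of_dvd hy]; ring

/-! ### Deaths: only the death of the full power of `p` flips the indicator -/

/-- For `d ∣ k` with `Λ(d) ≠ 0` (a prime power `q^b`): `p ∤ k/d` iff `p ∣ k` fails to survive, i.e. iff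
`d = p^{v_p(k)}`; packaged as the value of the flip. -/
theorem vonMangoldt_mul_parity_flip {p : ℕ} (hp : p.Prime) {k d : ℕ} (hk : k ≠ 0) (hd : d ∣ k) :
    Λ d * (parityFun p (k / d) - parityFun p k) =
      if d = p ^ k.factorization p ∧ p ∣ k then Real.log p else 0 := by
  by_cases hpk : p ∣ k
  · -- p ∣ k
    by_cases hdeq : d = p ^ k.factorization p
    · -- the full power: k/d is coprime to p, Λ(d) = log p
      subst hdeq
      have hv : 0 < k.factorization p := Nat.Prime.factorization_pos_of_dvd hp hk hpk
      have hnot : ¬ p ∣ k / p ^ k.factorization p := Nat.not_dvd_ordCompl hp hk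
      rw [if_pos ⟨rfl, hpk⟩, parityFun_sub_of_not_dvd_of_dvd hnot hpk, mul_one,
        vonMangoldt_apply_pow hv.ne', vonMangoldt_apply_prime hp]
    · rw [if_neg (fun h => hdeq h.1)]
      -- either Λ d = 0, or d is a prime power q^b with p ∣ k/d
      by_cases hΛ : Λ d = 0
      · rw [hΛ, zero_mul]
      · have hpp : IsPrimePow d := vonMangoldt_ne_zero_iff.1 hΛ
        obtain ⟨q, b, hq, hb, rfl⟩ := hpp
        have hqp : q.Prime := hq.nat_prime
        -- p ∣ k / q^b
        have hdiv : p ∣ k / q ^ b := by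
          by_cases hqeq : q = p
          · subst hqeq
            -- b < v_p(k) since q^b ∣ k and q^b ≠ q^{v}
            have hble : b ≤ k.factorization q := (Nat.Prime.pow_dvd_iff_le_factorization hqp hk).1 hd
            have hblt : b < k.factorization q := lt_of_le_of_ne hble (fun h => hdeq (by rw [h]))
            have h1 : q ^ (b + 1) ∣ k := (Nat.Prime.pow_dvd_iff_le_factorization hqp hk).2 hblt
            obtain ⟨c, hc⟩ := h1
            have : k / q ^ b = q * c := by
              rw [hc, pow_succ, mul_assoc, Nat.mul_div_cancel_left _ (pow_pos hqp.pos b)]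
            rw [this]; exact dvd_mul_right q c
          · have hcop : Nat.Coprime p (q ^ b) :=
              (Nat.coprime_primes hp hqp).2 (Ne.symm hqeq) |>.pow_right b
            obtain ⟨c, hc⟩ := hd
            have hkd : k / q ^ b = c := by
              rw [hc, Nat.mul_div_cancel_left _ (pow_pos hqp.pos b)]
            rw [hkd]
            have : p ∣ q ^ b * c := hc ▸ hpk
            exact hcop.dvd_of_dvd_mul_left this
        rw [parityFun_of_dvd hdiv, parityFun_of_dvd hpk, sub_self, mul_zero]
  · -- p ∤ k: no flip at all
    rw [if_neg (fun h => hpk h.2)]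
    have h1 : ¬ p ∣ k / d := fun h => hpk (h.trans (Nat.div_dvd_of_dvd hd))
    rw [parityFun_of_not_dvd h1, parityFun_of_not_dvd hpk, sub_self, mul_zero]

/-- **Deaths flip `φ_p` exactly once**: `Σ_{d ∣ k} Λ(d)·(φ_p(k/d) − φ_p(k)) = 𝟙[p ∣ k]·log p` (`k ≥ 1`). -/
theorem sum_divisors_vonMangoldt_parity {p : ℕ} (hp : p.Prime) {k : ℕ} (hk : k ≠ 0) :
    ∑ d ∈ k.divisors, Λ d * (parityFun p (k / d) - parityFun p k) =
      if p ∣ k then Real.log p else 0 := by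
  rw [Finset.sum_congr rfl fun d hd => vonMangoldt_mul_parity_flip hp hk (Nat.dvd_of_mem_divisors hd)]
  by_cases hpk : p ∣ k
  · rw [if_pos hpk]
    have hmem : p ^ k.factorization p ∈ k.divisors :=
      Nat.mem_divisors.2 ⟨Nat.ordProj_dvd k p, hk⟩
    rw [Finset.sum_ite, Finset.sum_const_zero, add_zero, Finset.sum_const]
    have : (k.divisors.filter fun d => d = p ^ k.factorization p ∧ p ∣ k) = {p ^ k.factorization p} := by
      ext d
      simp only [Finset.mem_filter, Finset.mem_singleton]
      constructor
      · rintro ⟨_, h, _⟩; exact h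
      · rintro rfl; exact ⟨hmem, rfl, hpk⟩
    rw [this, Finset.card_singleton, one_smul]
  · rw [if_neg hpk]
    refine Finset.sum_eq_zero fun d _ => ?_
    rw [if_neg (fun h => hpk h.2)]

/-! ### Births: only the births of powers of `p` from a `p`-free state flip the indicator -/

/-- **Births flip `φ_p` by `−1` exactly on the multiples of `p`**:
`Σ_{n ≤ y} (Λ(n)/n)·(φ_p(kn) − φ_p(k)) = −𝟙[p ∤ k]·Σ_{n ≤ y, p ∣ n} Λ(n)/n`. -/
theorem sum_Icc_vonMangoldt_parity {p : ℕ} (hp : p.Prime) (k y : ℕ) :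
    ∑ n ∈ Icc 1 y, Λ n / n * (parityFun p (k * n) - parityFun p k) =
      if p ∣ k then 0 else -∑ n ∈ (Icc 1 y).filter (fun n => p ∣ n), Λ n / n := by
  by_cases hpk : p ∣ k
  · rw [if_pos hpk]
    refine Finset.sum_eq_zero fun n _ => ?_
    rw [parityFun_of_dvd (hpk.mul_right n), parityFun_of_dvd hpk, sub_self, mul_zero]
  · rw [if_neg hpk, Finset.sum_filter, ← Finset.sum_neg_distrib]
    refine Finset.sum_congr rfl fun n _ => ?_
    by_cases hpn : p ∣ n
    · rw [if_pos hpn, parityFun_of_dvd (hpn.mul_left k), parityFun_of_not_dvd hpk]; ring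
    · have : ¬ p ∣ k * n := fun h => (hp.dvd_mul.1 h).elim hpk hpn
      rw [if_neg hpn, parityFun_of_not_dvd this, parityFun_of_not_dvd hpk, sub_self, mul_zero, neg_zero]

/-! ### The eigen-relation with defect -/

/-- **`ℒ_M φ_p = −(λ_p/L)φ_p + (1/L)·r_p`** (`λ_p = p log p/(p−1)`, `L = log M`): for every state `k`,
`Σ_j walkGen(k,j)·φ_p(j) = −(λ_p/L)·φ_p(k) + (1/L)·𝟙[p ∤ k]·(log p/(p−1) − Σ_{n ≤ M/k, p ∣ n} Λ(n)/n)`.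
In the untruncated chain the bracket vanishes (`Σ_{a ≥ 1} log p/p^a = log p/(p−1)`): `φ_p` is an exact
eigenfunction with rate `λ_p/L` (PIVOT-LAW 13.10 (iv)); the truncation leaves the BLOCKED-BIRTH defect. -/
theorem walkGen_parity {M p : ℕ} (hp : p.Prime) (k : St M) :
    ∑ j : St M, walkGen M k j * parityFun p j =
      -((p : ℝ) * Real.log p / ((p : ℝ) - 1) / Real.log M) * parityFun p k +
        (1 / Real.log M) * (if p ∣ (k : ℕ) then 0 else
          (Real.log p / ((p : ℝ) - 1) - ∑ n ∈ (Icc 1 (M / k)).filter (fun n => p ∣ n), Λ n / n)) := by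
  have hk : 1 ≤ (k : ℕ) := (Finset.mem_Icc.1 k.2).1
  have hk0 : (k : ℕ) ≠ 0 := by omega
  have hp1 : (1 : ℝ) < p := by exact_mod_cast hp.one_lt
  have hp0 : (p : ℝ) - 1 ≠ 0 := by linarith
  rw [walkGen_sum_eq_arith M (parityFun p) k]
  -- births
  have hB : ∑ n ∈ Icc 1 (M / k), (Λ n : ℝ) / ((n : ℝ) * Real.log M) * (parityFun p (k * n) - parityFun p k) =
      (1 / Real.log M) * ∑ n ∈ Icc 1 (M / k), Λ n / n * (parityFun p (k * n) - parityFun p k) := by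
    rw [Finset.mul_sum]
    refine Finset.sum_congr rfl fun n _ => ?_
    rw [div_mul_eq_div_div]; ring
  -- deaths
  have hD : ∑ d ∈ (k : ℕ).divisors, (Λ d : ℝ) / Real.log M * (parityFun p (k / d) - parityFun p k) =
      (1 / Real.log M) * ∑ d ∈ (k : ℕ).divisors, Λ d * (parityFun p (k / d) - parityFun p k) := by
    rw [Finset.mul_sum]
    refine Finset.sum_congr rfl fun d _ => ?_
    ring
  rw [hB, hD, sum_Icc_vonMangoldt_parity hp, sum_divisors_vonMangoldt_parity hp hk0]
  by_cases hpk : p ∣ (k : ℕ)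
  · rw [if_pos hpk, if_pos hpk, if_pos hpk, parityFun_of_dvd hpk]
    field_simp
    ring
  · rw [if_neg hpk, if_neg hpk, if_neg hpk, parityFun_of_not_dvd hpk]
    field_simp
    ring

/-! ### The defect is non-negative, at most `log p/(p−1)`, and equal to it on the top band -/

/-- Only powers of `p` contribute to `Σ_{n ≤ y, p ∣ n} Λ(n)/n`, whence `≤ Σ_{a ≥ 1} log p/p^a = log p/(p−1)`. -/
theorem sum_Icc_dvd_vonMangoldt_div_le {p : ℕ} (hp : p.Prime) (y : ℕ) :
    ∑ n ∈ (Icc 1 y).filter (fun n => p ∣ n), Λ n / n ≤ Real.log p / ((p : ℝ) - 1) := by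
  have hp1 : (1 : ℝ) < p := by exact_mod_cast hp.one_lt
  have hp0 : (0 : ℝ) < p := by linarith
  -- bound the filtered sum by the sum over n ∈ image (a ↦ p^(a+1)) (range y)
  set T : Finset ℕ := (Finset.range y).image (fun a => p ^ (a + 1)) with hT
  have hsub : ∀ n ∈ (Icc 1 y).filter (fun n => p ∣ n), Λ n / n ≠ 0 → n ∈ T := by
    intro n hn hne
    rw [Finset.mem_filter, Finset.mem_Icc] at hn
    have hΛ : Λ n ≠ 0 := by
      intro h; apply hne; rw [h, zero_div]
    obtain ⟨q, b, hq, hb, rfl⟩ := vonMangoldt_ne_zero_iff.1 hΛ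
    have hqp : q.Prime := hq.nat_prime
    have : p ∣ q := hp.dvd_of_dvd_pow hn.2
    have hqeq : q = p := ((Nat.prime_dvd_prime_iff_eq hp hqp).1 this).symm
    subst hqeq
    rw [hT, Finset.mem_image]
    refine ⟨b - 1, ?_, ?_⟩
    · rw [Finset.mem_range]
      have h2 : b ≤ q ^ b := (Nat.lt_pow_self hqp.one_lt).le
      omega
    · congr 1; omega
  have hnn : ∀ n ∈ (Icc 1 y).filter (fun n => p ∣ n), 0 ≤ Λ n / (n : ℝ) :=
    fun n _ => div_nonneg vonMangoldt_nonneg (Nat.cast_nonneg n)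
  have h1 : ∑ n ∈ (Icc 1 y).filter (fun n => p ∣ n), Λ n / n ≤ ∑ n ∈ T, Λ n / n := by
    rw [← Finset.sum_filter_ne_zero ((Icc 1 y).filter (fun n => p ∣ n))]
    refine Finset.sum_le_sum_of_subset_of_nonneg ?_ fun n _ _ => div_nonneg vonMangoldt_nonneg (Nat.cast_nonneg n)
    intro n hn
    rw [Finset.mem_filter] at hn
    exact hsub n hn.1 hn.2
  refine h1.trans ?_
  -- Σ_{n ∈ T} Λ n/n = Σ_{a < y} log p/p^(a+1) ≤ log p/(p-1)
  have hinj : Set.InjOn (fun a => p ^ (a + 1)) (Finset.range y : Set ℕ) := by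
    intro a _ b _ h
    have := Nat.pow_right_injective hp.two_le h
    omega
  rw [hT, Finset.sum_image hinj]
  have hterm : ∀ a ∈ Finset.range y, Λ (p ^ (a + 1)) / ((p ^ (a + 1) : ℕ) : ℝ) = Real.log p * (p : ℝ)⁻¹ ^ (a + 1) := by
    intro a _
    rw [vonMangoldt_apply_pow (Nat.succ_ne_zero a), vonMangoldt_apply_prime hp, Nat.cast_pow, inv_pow,
      div_eq_mul_inv]
  rw [Finset.sum_congr rfl hterm, ← Finset.mul_sum]
  -- geometric: Σ_{a<y} r^(a+1) ≤ r/(1-r) = 1/(p-1), r = 1/p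
  have hr0 : 0 ≤ (p : ℝ)⁻¹ := by positivity
  have hr1 : (p : ℝ)⁻¹ < 1 := inv_lt_one_of_one_lt₀ hp1
  have hgeom : ∑ a ∈ Finset.range y, (p : ℝ)⁻¹ ^ (a + 1) ≤ 1 / ((p : ℝ) - 1) := by
    have h2 : ∑ a ∈ Finset.range y, (p : ℝ)⁻¹ ^ (a + 1) = (p : ℝ)⁻¹ * ∑ a ∈ Finset.range y, (p : ℝ)⁻¹ ^ a := by
      rw [Finset.mul_sum]; refine Finset.sum_congr rfl fun a _ => by ring
    rw [h2]
    have h3 : ∑ a ∈ Finset.range y, (p : ℝ)⁻¹ ^ a ≤ (1 - (p : ℝ)⁻¹)⁻¹ :=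
      sum_le_hasSum (Finset.range y) (fun i _ => pow_nonneg hr0 i) (hasSum_geometric_of_lt_one hr0 hr1)
    have h4 : (p : ℝ)⁻¹ * (1 - (p : ℝ)⁻¹)⁻¹ = 1 / ((p : ℝ) - 1) := by
      field_simp
    rw [← h4]
    exact mul_le_mul_of_nonneg_left h3 hr0
  have hlog : 0 ≤ Real.log p := Real.log_nonneg hp1.le
  calc Real.log p * ∑ a ∈ Finset.range y, (p : ℝ)⁻¹ ^ (a + 1) ≤ Real.log p * (1 / ((p : ℝ) - 1)) :=
        mul_le_mul_of_nonneg_left hgeom hlog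
    _ = Real.log p / ((p : ℝ) - 1) := by ring

/-- The blocked-birth defect is non-negative. -/
theorem parityDefect_nonneg {p : ℕ} (hp : p.Prime) (y : ℕ) :
    0 ≤ Real.log p / ((p : ℝ) - 1) - ∑ n ∈ (Icc 1 y).filter (fun n => p ∣ n), Λ n / n :=
  sub_nonneg.2 (sum_Icc_dvd_vonMangoldt_div_le hp y)

/-- The blocked-birth defect is at most `log p/(p−1)`. -/
theorem parityDefect_le (p y : ℕ) :
    Real.log p / ((p : ℝ) - 1) - ∑ n ∈ (Icc 1 y).filter (fun n => p ∣ n), Λ n / n ≤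
      Real.log p / ((p : ℝ) - 1) :=
  sub_le_self _ (Finset.sum_nonneg fun n _ => div_nonneg vonMangoldt_nonneg (Nat.cast_nonneg n))

/-- On the top band (`y = M/k < p`, no birth of `p` possible) the defect is exactly `log p/(p−1)`. -/
theorem parityDefect_eq_of_lt {p y : ℕ} (hy : y < p) :
    Real.log p / ((p : ℝ) - 1) - ∑ n ∈ (Icc 1 y).filter (fun n => p ∣ n), Λ n / n =
      Real.log p / ((p : ℝ) - 1) := by
  have : (Icc 1 y).filter (fun n => p ∣ n) = ∅ := by
    ext n
    simp only [Finset.mem_filter, Finset.mem_Icc, Finset.notMem_empty, iff_false, not_and]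
    intro hn hpn
    have := Nat.le_of_dvd (by omega) hpn
    omega
  rw [this, Finset.sum_empty, sub_zero]

end Summit.RiemannHypothesis.RiemannHypothesis.Theorems.IntegerScrew

end
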